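import Mathlib
import Summits.Ventures.PercRepro2.LocRows
import Summits.Ventures.PercRepro2.SwRow
import Summits.Ventures.PercRepro2.SwOut
import Summits.Ventures.PercRepro2.SwAllRow
import Summits.Ventures.PercRepro2.SwOutAll
import Summits.Ventures.PercRepro2.SwOutArmFlip
import Summits.Ventures.PercRepro2.SwOutArmThm
import Summits.Ventures.PercRepro2.SwOutCoreDefs
import Summits.Ventures.PercRepro2.SwOutCoreKey
import Summits.Ventures.PercRepro2.SwOutJunctionH1Defs
import Summits.Ventures.PercRepro2.SwOutBigBlockDefs
import Summits.Ventures.PercRepro2.SwOutMixedBaseDefs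
import Summits.Ventures.PercRepro2.SwOutMixedBaseClasses
import Summits.Ventures.PercRepro2.SwOutMixedBaseHull
import Summits.Ventures.PercRepro2.SwOutMixedBaseDual
import Summits.Ventures.PercRepro2.SwOutMixedCore

/-!
# The core points of a mixed base: the clusters of `u`, the extended hull, the blue side and the
canonical base (blind cell PercRepro2, night-4 g19, 2026-08-27; proofs/NIGHT4-G19.md §4)

The mixed analogue of `SwOutCoreKey` (`CoreBase.cluster_coreReal_u`, `extHull_coreReal`,
`blueExt_coreReal`, `coreBaseOf_coreReal`).  At a CORE POINT `q` of the raw cube of a mixed base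
(`Core q`: the three coordinates `a = uP = e` of the mixed arm agree — the point is the base with
whole arms flipped, the mixed arm `Ah ∪ {p}` flipped as one), the point is non-leaking
(`not_leakR_of_core`, `not_leakB_of_core`); the red cluster of `u` is the red cluster of `h` when
some u-arm is red, else `u` with `p` when the u–p edges are red (`cluster_mixedReal_u_core`), and
dually (`cluster_blue_mixedReal_u_core`); hence `u` is in the hull of `h` (`u_mem_hull_core`), the
hull of `u` lies in `{h, u, p} ∪ arms` (`hull_u_core_subset`), the extended hull is exactly
`{h, u, p} ∪ arms` (`extHull_core`), the blue side is the union of the blue arms with `p` on the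
mixed arm's side (`blueExt_core`), and **the canonical base of every core point is the base**
(`coreBaseOf_core`).  With a region `Us ⊇ {h, u, p} ∪ arms` every core point is of the core kind
(`coreKind_core`).  These are the constancy facts of the KEY of the mixed kind along the core
points of a mixed block (the partition, NIGHT4-G18.md §7).
-/

namespace Summit.Ventures.PercRepro2

namespace BigBlock

open Hull LocRows

variable {V : Type*} {E : Type*}

open scoped Classical

section CorePoints

variable {ι κ : Type*} {ends : E → Sym2 V} {σ : Config E} {h u p : V} {U : ι → Set V} {Ah : Set V}
  {F : κ → Set V}

/-- A core point does not leak on the red side. -/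
lemma not_leakR_of_core {q : Pt ι κ} (hq : Core q) : ¬ LeakR q := by
  obtain ⟨s, a, uP, e, f⟩ := q
  obtain ⟨h1, h2⟩ := hq
  simp only at h1 h2
  subst h1
  subst h2
  rintro ⟨_, h3, h4 | h4⟩ <;> simp_all

/-- A core point does not leak on the blue side. -/
lemma not_leakB_of_core {q : Pt ι κ} (hq : Core q) : ¬ LeakB q := by
  obtain ⟨s, a, uP, e, f⟩ := q
  obtain ⟨h1, h2⟩ := hq
  simp only at h1 h2
  subst h1
  subst h2
  rintro ⟨_, h3, h4 | h4⟩ <;> simp_all [flipPt]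

/-- The flipped point of a core point is a core point. -/
lemma core_flipPt {q : Pt ι κ} (hq : Core q) : Core (flipPt q) := by
  obtain ⟨h1, h1'⟩ := hq
  exact ⟨by simp only [flipPt, h1], by simp only [flipPt, h1']⟩

/-- The cluster of a vertex of a cluster is that cluster. -/
lemma cluster_eq_of_mem' {ω : Config E} {v x : V} (hx : x ∈ cluster ends ω v) :
    cluster ends ω x = cluster ends ω v := by
  ext y
  exact ⟨fun hy => conn_trans hx hy, fun hy => conn_trans (conn_symm hx) hy⟩

variable (hb : MixedBase ends σ h u p U Ah F)
include hb

/-- **The red cluster of `u` at a core point**: the red cluster of `h` when some u-arm is red,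
else `u` together with `p` when the u–p edges are red. -/
theorem MixedBase.cluster_mixedReal_u_core (hup : ∃ e, ends e = s(u, p)) {q : Pt ι κ}
    (hq : Core q) :
    cluster ends (mixedReal ends u p U Ah F σ q) u =
      if ∃ j, q.1 j = true then redSetM h u p U Ah F q
      else {u} ∪ {x | x = p ∧ q.2.2.1 = true} := by
  split_ifs with hs
  · -- `u` lies in the red cluster of `h`
    have hu : u ∈ cluster ends (mixedReal ends u p U Ah F σ q) h := by
      rw [hb.cluster_mixedReal hup (not_leakR_of_core hq), mem_redSetM_iff]
      exact Or.inr (Or.inr (Or.inl ⟨rfl, hs⟩))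
    rw [cluster_eq_of_mem' hu, hb.cluster_mixedReal hup (not_leakR_of_core hq)]
  · have hs' : ∀ j, q.1 j ≠ true := fun j hj => hs ⟨j, hj⟩
    apply Set.Subset.antisymm
    · -- closure: the red edges at `u` and at `p` stay inside
      refine fun v hv => mem_of_conn_of_closed (ends := ends)
        (ω := mixedReal ends u p U Ah F σ q) ?_ (Or.inl rfl) hv
      intro a ha b hab
      obtain ⟨_, e, he, hends⟩ := openGraph_adj.1 hab
      rcases ha with ha | ⟨hap, huP⟩
      · rw [Set.mem_singleton_iff] at ha
        subst ha
        rcases hb.u_edges e b hends with ⟨j, hj⟩ | rfl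
        · exfalso
          have ht : e ∈ touches ends (U j) := ⟨b, hj, a, ends_swap hends⟩
          rw [hb.mixedReal_apply_U ht, if_neg (hs' j), hb.u_red e b hends] at he
          exact Bool.noConfusion he
        · by_cases huP : q.2.2.1 = true
          · exact Or.inr ⟨rfl, huP⟩
          · exfalso
            rw [hb.mixedReal_apply_UP hends, if_neg huP, hb.u_red e b hends] at he
            exact Bool.noConfusion he
      · -- from `p`: the dead edges and the outside edges are blue at a core point
        obtain ⟨ha, ha'⟩ := hq
        rw [huP] at ha ha'
        rw [hap] at hends
        rcases hb.p_edges e b hends with hbu | hbA | ⟨_, _, hbarms⟩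
        · exact Or.inl hbu
        · exfalso
          have ht : e ∈ touches ends Ah := ⟨b, hbA, p, ends_swap hends⟩
          rw [hb.mixedReal_apply_Ah ht, if_pos ha, hb.dead_blue e b hends hbA] at he
          exact Bool.noConfusion he
        · by_cases hbu : b = u
          · exact Or.inl hbu
          exfalso
          have hbA : b ∉ Ah := fun hbA => hbarms (Or.inl (Or.inr hbA))
          have hx : e ∈ clsExt ends u p Ah := ⟨b, hends, hbu, hbA⟩
          rw [hb.mixedReal_apply_Ext hx, if_pos ha'.symm, hb.ext_blue e b hends hbu hbA] at he
          exact Bool.noConfusion he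
    · rintro v (hv | ⟨hvp, huP⟩)
      · rw [Set.mem_singleton_iff] at hv
        rw [hv]
        exact mem_cluster_self _ _ _
      · rw [hvp]
        obtain ⟨e, he⟩ := hup
        have hred : mixedReal ends u p U Ah F σ q e = true := by
          rw [hb.mixedReal_apply_UP he, if_pos huP]
          exact hb.u_red e p he
        exact mem_cluster_of_edge (mem_cluster_self _ _ _) hred he

/-- **The two red clusters at a core point**: `C_R(h) ∪ C_R(u)` is the red set with `u` and, when
the u–p edges are red, `p`. -/
theorem MixedBase.cluster_union_core (hup : ∃ e, ends e = s(u, p)) {q : Pt ι κ} (hq : Core q) :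
    cluster ends (mixedReal ends u p U Ah F σ q) h ∪ cluster ends (mixedReal ends u p U Ah F σ q) u =
      redSetM h u p U Ah F q ∪ {u} ∪ {x | x = p ∧ q.2.2.1 = true} := by
  rw [hb.cluster_mixedReal hup (not_leakR_of_core hq), hb.cluster_mixedReal_u_core hup hq]
  split_ifs with hs
  · have hu : u ∈ redSetM h u p U Ah F q := by
      rw [mem_redSetM_iff]; exact Or.inr (Or.inr (Or.inl ⟨rfl, hs⟩))
    ext x
    simp only [Set.mem_union, Set.mem_singleton_iff, Set.mem_setOf_eq, or_self]
    constructor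
    · exact fun hx => Or.inl (Or.inl hx)
    · rintro ((hx | hxu) | ⟨hxp, huP⟩)
      · exact hx
      · rw [hxu]; exact hu
      · rw [hxp, mem_redSetM_iff]; exact Or.inr (Or.inr (Or.inr (Or.inl ⟨rfl, hs, huP⟩)))
  · rw [Set.union_assoc]

/-- **The two blue clusters at a core point** (by duality). -/
theorem MixedBase.cluster_blue_union_core (hup : ∃ e, ends e = s(u, p)) {q : Pt ι κ}
    (hq : Core q) :
    cluster ends (blue (mixedReal ends u p U Ah F σ q)) h ∪
        cluster ends (blue (mixedReal ends u p U Ah F σ q)) u =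
      redSetM h u p U Ah F (flipPt q) ∪ {u} ∪ {x | x = p ∧ q.2.2.1 = false} := by
  rw [hb.blue_mixedReal, hb.dual.cluster_union_core hup (core_flipPt hq)]
  simp only [flipPt, Bool.not_eq_true']

/-- `u` lies in the hull of `h` at every core point (some u-arm exists). -/
theorem MixedBase.u_mem_hull_core [Nonempty ι] (hup : ∃ e, ends e = s(u, p)) {q : Pt ι κ}
    (hq : Core q) : u ∈ hull ends (mixedReal ends u p U Ah F σ q) h := by
  obtain ⟨j⟩ := ‹Nonempty ι›
  cases hj : q.1 j with
  | true =>
    left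
    rw [hb.cluster_mixedReal hup (not_leakR_of_core hq), mem_redSetM_iff]
    exact Or.inr (Or.inr (Or.inl ⟨rfl, j, hj⟩))
  | false =>
    right
    rw [hb.cluster_blue_mixedReal hup (not_leakB_of_core hq), mem_redSetM_iff]
    refine Or.inr (Or.inr (Or.inl ⟨rfl, j, ?_⟩))
    simp only [flipPt, flipAll, hj, Bool.not_false]

/-- The hull of `u` at a core point lies in `{h, u, p} ∪ arms`. -/
theorem MixedBase.hull_u_core_subset (hup : ∃ e, ends e = s(u, p)) {q : Pt ι κ} (hq : Core q) :
    hull ends (mixedReal ends u p U Ah F σ q) u ⊆ {h} ∪ {u} ∪ {p} ∪ armsAll U Ah F := by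
  intro x hx
  have key : ∀ (q' : Pt ι κ) (σ' : Config E), MixedBase ends σ' h u p U Ah F → Core q' →
      ∀ y ∈ cluster ends (mixedReal ends u p U Ah F σ' q') u, y ∈ {h} ∪ {u} ∪ {p} ∪ armsAll U Ah F := by
    intro q' σ' hb' hq' y hy
    rw [hb'.cluster_mixedReal_u_core hup hq'] at hy
    split_ifs at hy with hs
    · exact redSetM_subset hy
    · rcases hy with hy | ⟨rfl, _⟩
      · rw [Set.mem_singleton_iff] at hy
        exact Or.inl (Or.inl (Or.inr hy))
      · exact Or.inl (Or.inr rfl)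
  rcases hx with hx | hx
  · exact key q σ hb hq x hx
  · rw [hb.blue_mixedReal] at hx
    exact key (flipPt q) _ hb.dual (core_flipPt hq) x hx

omit hb in
/-- `p` lies in the hull of `u` at every point (the u–p edges have one colour). -/
theorem p_mem_hull_u (hup : ∃ e, ends e = s(u, p)) (q : Pt ι κ) :
    p ∈ hull ends (mixedReal ends u p U Ah F σ q) u := by
  obtain ⟨e, he⟩ := hup
  cases hc : mixedReal ends u p U Ah F σ q e with
  | true => exact Or.inl (mem_cluster_of_edge (mem_cluster_self _ _ _) hc he)
  | false =>
    have hc' : blue (mixedReal ends u p U Ah F σ q) e = true := by rw [blue_eq_true_iff]; exact hc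
    exact Or.inr (mem_cluster_of_edge (mem_cluster_self _ _ _) hc' he)

/-- Every arm vertex lies in the hull of `h` at a core point. -/
theorem MixedBase.armsAll_subset_hull_core (hup : ∃ e, ends e = s(u, p)) {q : Pt ι κ}
    (hq : Core q) {x : V} (hx : x ∈ armsAll U Ah F) :
    x ∈ hull ends (mixedReal ends u p U Ah F σ q) h := by
  have hR := hb.cluster_mixedReal hup (not_leakR_of_core hq)
  have hB := hb.cluster_blue_mixedReal hup (not_leakB_of_core hq)
  rcases hx with (hx | hx) | hx
  · obtain ⟨j, hj⟩ := Set.mem_iUnion.1 hx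
    cases hs : q.1 j with
    | true =>
      left; rw [hR, mem_redSetM_iff]; exact Or.inr (Or.inl ⟨j, hs, hj⟩)
    | false =>
      right; rw [hB, mem_redSetM_iff]
      refine Or.inr (Or.inl ⟨j, ?_, hj⟩)
      simp only [flipPt, flipAll, hs, Bool.not_false]
  · cases ha : q.2.1 with
    | true =>
      left; rw [hR, mem_redSetM_iff]; exact Or.inr (Or.inr (Or.inr (Or.inr (Or.inl ⟨ha, hx⟩))))
    | false =>
      right; rw [hB, mem_redSetM_iff]
      refine Or.inr (Or.inr (Or.inr (Or.inr (Or.inl ⟨?_, hx⟩))))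
      simp only [flipPt, ha, Bool.not_false]
  · obtain ⟨k, hk⟩ := Set.mem_iUnion.1 hx
    cases hf : q.2.2.2.2 k with
    | true =>
      left; rw [hR, mem_redSetM_iff]; exact Or.inr (Or.inr (Or.inr (Or.inr (Or.inr ⟨k, hf, hk⟩))))
    | false =>
      right; rw [hB, mem_redSetM_iff]
      refine Or.inr (Or.inr (Or.inr (Or.inr (Or.inr ⟨k, ?_, hk⟩))))
      simp only [flipPt, flipAll, hf, Bool.not_false]

/-- **The extended hull of a core point is `{h, u, p} ∪ arms`.** -/
theorem MixedBase.extHull_core [Nonempty ι] (hup : ∃ e, ends e = s(u, p)) {q : Pt ι κ}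
    (hq : Core q) :
    extHull ends (mixedReal ends u p U Ah F σ q) h u = {h} ∪ {u} ∪ {p} ∪ armsAll U Ah F := by
  apply Set.Subset.antisymm
  · rintro x (hx | hx)
    · exact hb.hull_mixedReal_subset hup (not_leakR_of_core hq) (not_leakB_of_core hq) hx
    · exact hb.hull_u_core_subset hup hq hx
  · rintro x (((rfl | rfl) | rfl) | hx)
    · exact Or.inl (Or.inl (mem_cluster_self _ _ _))
    · exact Or.inl (hb.u_mem_hull_core hup hq)
    · exact Or.inr (p_mem_hull_u hup q)
    · exact Or.inl (hb.armsAll_subset_hull_core hup hq hx)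

/-- **The blue side of a core point**: the blue u-arms, the h-piece with `p` when the mixed arm
is blue, and the blue far arms. -/
theorem MixedBase.blueExt_core (hup : ∃ e, ends e = s(u, p)) {q : Pt ι κ} (hq : Core q) :
    blueExt ends (mixedReal ends u p U Ah F σ q) h u =
      {x | ∃ j, q.1 j = false ∧ x ∈ U j} ∪ {x | q.2.1 = false ∧ (x = p ∨ x ∈ Ah)} ∪
        {x | ∃ k, q.2.2.2.2 k = false ∧ x ∈ F k} := by
  have hhu := hb.hne_hu
  have hhp := hb.hne_hp
  have hup' := hb.hne_up
  obtain ⟨ha, ha'⟩ := hq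
  have haP : q.2.2.1 = q.2.1 := ha.symm
  unfold blueExt
  rw [hb.cluster_blue_union_core hup ⟨ha, ha'⟩]
  ext x
  simp only [Set.mem_sdiff, Set.mem_union, Set.mem_singleton_iff, Set.mem_setOf_eq,
    Set.mem_insert_iff, not_or, mem_redSetM_iff, flipPt, flipAll, Bool.not_eq_true']
  constructor
  · rintro ⟨((hx | hxu) | ⟨hxp, huP⟩), hxh, hxu'⟩
    · rcases hx with hx | hx | hx | hx | hx | hx
      · exact absurd hx hxh
      · exact Or.inl (Or.inl hx)
      · exact absurd hx.1 hxu'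
      · exact Or.inl (Or.inr ⟨by rw [← haP]; exact hx.2.2, Or.inl hx.1⟩)
      · exact Or.inl (Or.inr ⟨hx.1, Or.inr hx.2⟩)
      · exact Or.inr hx
    · exact absurd hxu hxu'
    · exact Or.inl (Or.inr ⟨by rw [← haP]; exact huP, Or.inl hxp⟩)
  · rintro ((⟨j, hj, hx⟩ | ⟨ha0, hxp | hx⟩) | ⟨k, hk, hx⟩)
    · refine ⟨Or.inl (Or.inl (Or.inr (Or.inl ⟨j, hj, hx⟩))), ?_, ?_⟩
      · intro hxh; rw [hxh] at hx; exact hb.h_notMem_U j hx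
      · intro hxu; rw [hxu] at hx; exact hb.u_notMem_U j hx
    · refine ⟨Or.inr ⟨hxp, by rw [haP]; exact ha0⟩, ?_, ?_⟩
      · rw [hxp]; exact hhp.symm
      · rw [hxp]; exact hup'.symm
    · refine ⟨Or.inl (Or.inl (Or.inr (Or.inr (Or.inr (Or.inr (Or.inl ⟨ha0, hx⟩)))))), ?_, ?_⟩
      · intro hxh; rw [hxh] at hx; exact hb.h_notMem_Ah hx
      · intro hxu; rw [hxu] at hx; exact hb.u_notMem_Ah hx
    · refine ⟨Or.inl (Or.inl (Or.inr (Or.inr (Or.inr (Or.inr (Or.inr ⟨k, hk, hx⟩)))))), ?_, ?_⟩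
      · intro hxh; rw [hxh] at hx; exact hb.h_notMem_F k hx
      · intro hxu; rw [hxu] at hx; exact hb.u_notMem_F k hx

/-- The flipped classes of a core point are exactly the edges touching its blue side. -/
theorem MixedBase.flipSet_core (hup : ∃ e, ends e = s(u, p)) {q : Pt ι κ} (hq : Core q) (e : E) :
    e ∈ flipSet ends u p U Ah F q ↔
      e ∈ touches ends (blueExt ends (mixedReal ends u p U Ah F σ q) h u) := by
  rw [hb.blueExt_core hup hq]
  obtain ⟨ha, ha'⟩ := hq
  constructor
  · rintro ((((⟨j, hj, x, hx, y, hxy⟩ | ⟨hA, x, hx, y, hxy⟩) | ⟨hc, hup'⟩) | ⟨hc, z, hpz, _, _⟩) |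
      ⟨k, hk, x, hx, y, hxy⟩)
    · exact ⟨x, Or.inl (Or.inl ⟨j, hj, hx⟩), y, hxy⟩
    · exact ⟨x, Or.inl (Or.inr ⟨hA, Or.inr hx⟩), y, hxy⟩
    · exact ⟨p, Or.inl (Or.inr ⟨by rw [ha]; exact hc, Or.inl rfl⟩), u, ends_swap hup'⟩
    · exact ⟨p, Or.inl (Or.inr ⟨by rw [ha, ha']; exact hc, Or.inl rfl⟩), z, hpz⟩
    · exact ⟨x, Or.inr ⟨k, hk, hx⟩, y, hxy⟩
  · rintro ⟨x, ((⟨j, hj, hx⟩ | ⟨ha0, hxp | hx⟩) | ⟨k, hk, hx⟩), y, hxy⟩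
    · exact Or.inl (Or.inl (Or.inl (Or.inl ⟨j, hj, x, hx, y, hxy⟩)))
    · -- an edge at `p`: to `u`, into the h-piece, or outside
      rw [hxp] at hxy
      by_cases hyu : y = u
      · rw [hyu] at hxy
        exact Or.inl (Or.inl (Or.inr ⟨by rw [← ha]; exact ha0, ends_swap hxy⟩))
      by_cases hyA : y ∈ Ah
      · exact Or.inl (Or.inl (Or.inl (Or.inr ⟨ha0, y, hyA, p, ends_swap hxy⟩)))
      · exact Or.inl (Or.inr ⟨by rw [← ha', ← ha]; exact ha0, y, hxy, hyu, hyA⟩)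
    · exact Or.inl (Or.inl (Or.inl (Or.inr ⟨ha0, x, hx, y, hxy⟩)))
    · exact Or.inr ⟨k, hk, x, hx, y, hxy⟩

/-- **The canonical base of every core point is the base.** -/
theorem MixedBase.coreBaseOf_core (hup : ∃ e, ends e = s(u, p)) {q : Pt ι κ} (hq : Core q) :
    coreBaseOf ends (mixedReal ends u p U Ah F σ q) h u = σ := by
  funext e
  unfold coreBaseOf
  by_cases he : e ∈ touches ends (blueExt ends (mixedReal ends u p U Ah F σ q) h u)
  · rw [flip_apply_of_mem he]
    unfold mixedReal
    rw [if_pos ((hb.flipSet_core hup hq e).2 he), Bool.not_not]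
  · rw [flip_apply_of_notMem he]
    unfold mixedReal
    rw [if_neg (fun h' => he ((hb.flipSet_core hup hq e).1 h'))]

/-- Every core point is of the core kind in a region containing `{h, u, p}` and the arms. -/
theorem MixedBase.coreKind_core [Nonempty ι] (hup : ∃ e, ends e = s(u, p)) {Us : Set V}
    (hUs : {h} ∪ {u} ∪ {p} ∪ armsAll U Ah F ⊆ Us) {q : Pt ι κ} (hq : Core q) :
    CoreKind ends Us h u (mixedReal ends u p U Ah F σ q) :=
  ⟨hb.u_mem_hull_core hup hq, (hb.hull_u_core_subset hup hq).trans hUs⟩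

end CorePoints

end BigBlock

end Summit.Ventures.PercRepro2
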